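import Summits.NavierStokesRegularity.NavierStokesRegularity.Theorems.StrainDoorsTypeITangentLaw
import HarnessLib

/-!
# Strain doors, PART J — the record identity (ROUND 59 of the ns-regularity-ideate cell)

(Tree file 1 of 2 of PART J — §J1–§J4 (magnitude identity, two-sided Fermat, record identities: classical / tangent / DSS); §J5–§J6 (sandwich, uniform derivative bounds, pinch) are in `StrainDoorsRecordIdentity`, which imports this file.
Text of nsreg-p1 g35 r59/StrainDoorsRecordIdentity.lean sha256 acddde1084c15eaa, split at the 400-line cap at a § boundary,
bodies verbatim.)

At an ATTAINED record of the vorticity number `(T − t)|ω|` the time maximum is TWO-SIDED, so the Fermat step of the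
record law (R53) is an EQUALITY, and the magnitude computation at the spatial maximum (`ArgmaxDoorsGrowth` E1) is an
IDENTITY with one signed term `νΔ|ω| ≤ 0`.  Hence, at an attained record `(t̄, x̄)` of a classical solution
(`vorticity_record_identity`), of every DSS singularity (`dss_vorticity_record_identity`, on R53's attainment) and
on the TANGENT FIELD of every classical Type-I solution with `ω ≢ 0` (`typeI_tangent_record_identity`, on PART H/I):
`(T − t̄)(α − ν|∇ξ|²_F) − 1 = (T − t̄)·ν·(−Δ|ω|)(x̄)/|ω(x̄)| ≥ 0` and `(T − t̄)·α − 1 = (T − t̄)·ν·(−⟪ξ, Δω⟫)(x̄)/|ω(x̄)|`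
(`typeI_tangent_record_sandwich`): the excess of the record law is EXACTLY the scaled viscous curvature of the
vorticity magnitude at its peak, and the stretching rate is sandwiched
`1 + (T − t̄)ν|∇ξ|²_F ≤ (T − t̄)α ≤ 1 + (T − t̄)ν|Δω(x̄)|/|ω(x̄)|`.  With the uniform third-derivative bound of
Type-I tangent fields (`tangent_deriv_bound`, KNSS (4.11)) this PINCHES the stretching rate at the record to the
clock rate and bounds the twist: `(0 − (−1))ᾱ − 1 ≤ K₃(C₀)/W*`, `|∇ξ̄|²_F ≤ K₃(C₀)/W*` (`typeI_tangent_record_pinch`).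

References: Koch–Nadirashvili–Seregin–Šverák, Acta Math. 203 (2009), §4 [KNSS2009]; Galanti–Gibbon–Heritage,
Nonlinearity 10 (1997) (Dw4) [GalantiGibbonHeritage1997]; Constantin–Fefferman, Indiana Univ. Math. J. 42 (1993).
-/

noncomputable section

open MeasureTheory Set Function Filter Metric Real InnerProductSpace
open _root_.Topology
open scoped ENNReal NNReal RealInnerProductSpace ContDiff Laplacian
open Literature.Analysis Literature.Analysis.FluidPDE
open Literature.Analysis.FluidPDE.VorticityDirectionDynamics

set_option linter.unusedVariables false
set_option linter.unusedSectionVars false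

namespace Summit.NavierStokesRegularity.NavierStokesRegularity.Theorems.StrainDoors

open Summit.NavierStokesRegularity.NavierStokesRegularity.Theorems.ArgmaxDoors

/-! # PART J — THE RECORD IDENTITY (ROUND 59)

At an ATTAINED record the vorticity number has a TWO-SIDED maximum in time, so Fermat is an EQUALITY; and at a
non-zero spatial maximum of `|ω|` the magnitude computation is an IDENTITY with one signed term, `νΔ|ω| ≤ 0`.
Together: at an attained record `(t̄, x̄)` of `(T − t)|ω|` of a classical solution,
`(T − t̄)(α − ν|∇ξ|²_F) − 1 = (T − t̄)·ν·(−Δ|ω|)(t̄,x̄)/|ω(t̄,x̄)| ≥ 0` — the EXCESS of the record law is EXACTLY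
the scaled viscous curvature of the vorticity magnitude at its peak.  Proved for the tangent field of every
classical Type-I solution (§J3, on PART H/I) and for every DSS singularity (§J4, on R53's attainment). -/

/-! ## §J1 The magnitude identity at a spatial maximum and the two-sided Fermat equality -/

section RecordIdentityEngine

set_option maxSynthPendingDepth 3

/-- **The magnitude identity at a non-zero spatial maximum of `|ω|` (equality form of E1
`inner_vorticity_rhs_le_at_argmax`).**  `v ∈ C^∞`, `ω = curl v`, `x̄` a global maximum point of `|ω|` with
`ω(x̄) ≠ 0`, `w + (v·∇)ω(x̄) = (ω·∇)v(x̄) + νΔω(x̄)`.  Then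
`⟪ω(x̄), w⟫ = (α − ν|∇ξ|²_F)|ω|² + ν|ω|·Δ|ω|(x̄)`  and  `Δ|ω|(x̄) ≤ 0`
(`⟪ω,(ω·∇)v⟫ = α|ω|²`; `⟪ω,(v·∇)ω⟫ = ½∂_v|ω|² = 0` at the maximum; `⟪ξ,Δω⟫ = Δ|ω| − |ω||∇ξ|²_F`, GGH97 (Dw4)).
[folklore] -/
theorem inner_vorticity_rhs_eq_at_argmax (ν : ℝ)
    {v : (EuclideanSpace ℝ (Fin 3)) → (EuclideanSpace ℝ (Fin 3))} (hv : ContDiff ℝ ∞ v)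
    {x₀ : EuclideanSpace ℝ (Fin 3)} (hmax : ∀ x, ‖curl v x‖ ≤ ‖curl v x₀‖) (hne : curl v x₀ ≠ 0)
    {w : EuclideanSpace ℝ (Fin 3)}
    (hw : w + convect v (curl v) x₀ = convect (curl v) v x₀ + ν • (Δ (curl v)) x₀) :
    ⟪curl v x₀, w⟫ =
      (⟪vorticityDirection (curl v) x₀, fderiv ℝ v x₀ (vorticityDirection (curl v) x₀)⟫ -
          ν * frobeniusNormSq (fderiv ℝ (vorticityDirection (curl v)) x₀)) * ‖curl v x₀‖ ^ 2 +
        ν * ‖curl v x₀‖ * (Δ fun y => ‖curl v y‖) x₀ ∧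
    (Δ fun y => ‖curl v y‖) x₀ ≤ 0 := by
  set om : (EuclideanSpace ℝ (Fin 3)) → (EuclideanSpace ℝ (Fin 3)) := curl v with homdef
  have hom : ContDiff ℝ ∞ om :=
    contDiff_curl (n := ⊤) (hv.of_le (by exact_mod_cast (le_top : (⊤ + 1 : ℕ∞) ≤ ⊤)))
  have homC2 : ContDiff ℝ 2 om := contDiff_infty.mp hom 2
  have hom2 : ContDiffAt ℝ 2 om x₀ := homC2.contDiffAt
  set ρ : ℝ := ‖om x₀‖ with hρdef
  have hρ : 0 < ρ := norm_pos_iff.2 hne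
  set ξ := vorticityDirection om x₀ with hξdef
  have heq : w = convect om v x₀ + ν • (Δ om) x₀ - convect v om x₀ := eq_sub_of_add_eq hw
  -- (a) stretching
  have h1 : om x₀ = ρ • ξ := by rw [hξdef, hρdef, norm_smul_vorticityDirection]
  have ha : ⟪om x₀, convect om v x₀⟫ = ⟪ξ, fderiv ℝ v x₀ ξ⟫ * ρ ^ 2 := by
    rw [convect_apply]
    conv_lhs => rw [h1]
    rw [map_smul, inner_smul_left, inner_smul_right]
    simp only [conj_trivial]
    ring
  -- (b) transport vanishes at the maximum
  have hmax2 : ∀ x, ‖om x‖ ^ 2 ≤ ‖om x₀‖ ^ 2 := fun x =>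
    pow_le_pow_left₀ (norm_nonneg _) (hmax x) 2
  have hb : ⟪om x₀, convect v om x₀⟫ = 0 := by
    rw [convect_apply]
    exact inner_fderiv_eq_zero_of_forall_norm_sq_le hom hmax2 _
  -- (c) diffusion: the identity `⟪om, Δom⟫ = ρ(Δ|om| − ρ|∇ξ|²_F)` and the sign `Δ|om|(x₀) ≤ 0`
  have hlapnorm : (Δ fun y => ‖om y‖) x₀ ≤ 0 := by
    have hopen : IsOpen {y : EuclideanSpace ℝ (Fin 3) | om y ≠ 0} :=
      isOpen_ne_fun hom.continuous continuous_const
    have hC2 : ContDiffOn ℝ 2 (fun y => ‖om y‖) {y | om y ≠ 0} := fun y hy =>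
      ((homC2.contDiffAt).norm ℝ hy).contDiffWithinAt
    have hloc : IsLocalMax (fun y => ‖om y‖) x₀ := Filter.Eventually.of_forall hmax
    exact laplacian_nonpos_of_isLocalMax_of_contDiffOn hopen hne hC2 hloc
  have h2 : ⟪ξ, (Δ om) x₀⟫ = (Δ fun y => ‖om y‖) x₀ -
      ρ * frobeniusNormSq (fderiv ℝ (vorticityDirection om) x₀) := by
    have h := laplacian_norm_eq hom2 hne
    rw [hξdef, hρdef]; linarith
  have hc : ⟪om x₀, (Δ om) x₀⟫ =
      ρ * ((Δ fun y => ‖om y‖) x₀ - ρ * frobeniusNormSq (fderiv ℝ (vorticityDirection om) x₀)) := by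
    rw [h1, inner_smul_left]
    simp only [conj_trivial]
    rw [h2]
  refine ⟨?_, hlapnorm⟩
  rw [heq, inner_sub_right, inner_add_right, inner_smul_right, ha, hb, sub_zero, hc]
  ring

end RecordIdentityEngine

/-- **Two-sided Fermat for a record function with a classical derivative.**  If `s ↦ (T − s)|ω(s)|` has a
(two-sided) local maximum at `t < T` and `ω` has derivative `D` at `t`, then
`|ω(t)|² = (T − t)⟪ω(t), D⟫` (equality) and `s ↦ (T − s)²|ω(s)|²` is STATIONARY at `t`. [folklore] -/
theorem fermat_two_sided_of_hasDerivAt {om : ℝ → (EuclideanSpace ℝ (Fin 3))} {D : EuclideanSpace ℝ (Fin 3)}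
    {t T : ℝ} (hd : HasDerivAt om D t) (htT : t < T)
    (hrec : IsLocalMax (fun s => (T - s) * ‖om s‖) t) :
    ‖om t‖ ^ 2 = (T - t) * ⟪om t, D⟫ ∧ HasDerivAt (fun s => (T - s) ^ 2 * ‖om s‖ ^ 2) 0 t := by
  have hTt : 0 < T - t := sub_pos.mpr htT
  have hg : HasDerivAt (fun s => ‖om s‖ ^ 2) (2 * ⟪om t, D⟫) t := hd.norm_sq
  have hl : HasDerivAt (fun s : ℝ => T - s) (-1) t := by
    simpa using (hasDerivAt_id t).const_sub T
  have hF : HasDerivAt (fun s => (T - s) * (T - s) * ‖om s‖ ^ 2)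
      ((-1 * (T - t) + (T - t) * -1) * ‖om t‖ ^ 2 + (T - t) * (T - t) * (2 * ⟪om t, D⟫)) t :=
    (hl.mul hl).mul hg
  have hrecF : IsLocalMax (fun s => (T - s) * (T - s) * ‖om s‖ ^ 2) t := by
    show ∀ᶠ s in 𝓝 t, (T - s) * (T - s) * ‖om s‖ ^ 2 ≤ (T - t) * (T - t) * ‖om t‖ ^ 2
    filter_upwards [hrec, Iio_mem_nhds htT] with s hs hsT
    have h0 : 0 ≤ (T - s) * ‖om s‖ := mul_nonneg (sub_pos.mpr hsT).le (norm_nonneg _)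
    have h2 := mul_self_le_mul_self h0 hs
    have e1 : ∀ r : ℝ, (T - r) * ‖om r‖ * ((T - r) * ‖om r‖) = (T - r) * (T - r) * ‖om r‖ ^ 2 :=
      fun r => by ring
    rw [e1, e1] at h2
    exact h2
  have hzero := hrecF.hasDerivAt_eq_zero hF
  have key : (T - t) * ‖om t‖ ^ 2 = (T - t) * ((T - t) * ⟪om t, D⟫) := by nlinarith [hzero, hTt]
  refine ⟨mul_left_cancel₀ hTt.ne' key, ?_⟩
  have hF0 : HasDerivAt (fun s => (T - s) * (T - s) * ‖om s‖ ^ 2) 0 t := hzero ▸ hF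
  refine hF0.congr_of_eventuallyEq (Filter.Eventually.of_forall fun s => ?_)
  show (T - s) ^ 2 * ‖om s‖ ^ 2 = (T - s) * (T - s) * ‖om s‖ ^ 2
  ring

/-! ## §J2 The record identity for classical solutions -/

/-- ★★ **THE VORTICITY RECORD IDENTITY (classical solutions).**  Classical unforced solution on `S` (`S` uniquely
differentiable, `S ∈ 𝓝 t`), `t < T`, a point `x` with `ω(t,x) ≠ 0` which is a spatial maximum of `|ω(t,·)|` and a
TWO-SIDED local maximum in time of `s ↦ (T − s)|ω(s,x)|` (an ATTAINED record).  Then, with `ξ = ω/|ω|`,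
`α = ⟪ξ, ∇u ξ⟫` at `(t,x)`:
`(T − t)(α − ν|∇ξ|²_F) = 1 + (T − t)·ν·(−Δ|ω|(t,x))/|ω(t,x)|`,  with  `0 ≤ −Δ|ω|(t,x)` —
the excess in the record law `1 ≤ (T − t)(α − ν|∇ξ|²_F)` is exactly the scaled viscous curvature of `|ω|` at its
peak; the law is SATURATED iff `Δ|ω| = 0` at the peak. [new-as-typed] -/
theorem vorticity_record_identity {ν T : ℝ} {S : Set ℝ}
    {u : ℝ → (EuclideanSpace ℝ (Fin 3)) → (EuclideanSpace ℝ (Fin 3))} {p : ℝ → (EuclideanSpace ℝ (Fin 3)) → ℝ}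
    (hS : UniqueDiffOn ℝ S) (hsol : IsClassicalNSSolutionOn S ν 0 u p)
    {t : ℝ} (ht : S ∈ 𝓝 t) (htT : t < T) {x : EuclideanSpace ℝ (Fin 3)}
    (hmaxX : ∀ y, ‖curl (u t) y‖ ≤ ‖curl (u t) x‖)
    (hmaxT : IsLocalMax (fun s => (T - s) * ‖curl (u s) x‖) t)
    (hne : curl (u t) x ≠ 0) :
    (T - t) *
        (⟪vorticityDirection (curl (u t)) x, fderiv ℝ (u t) x (vorticityDirection (curl (u t)) x)⟫ -
          ν * frobeniusNormSq (fderiv ℝ (vorticityDirection (curl (u t))) x)) =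
      1 + (T - t) * ν * (-(Δ fun y => ‖curl (u t) y‖) x) / ‖curl (u t) x‖ ∧
    0 ≤ -(Δ fun y => ‖curl (u t) y‖) x ∧
    HasDerivAt (fun s => (T - s) ^ 2 * ‖curl (u s) x‖ ^ 2) 0 t := by
  have ht' : t ∈ S := mem_of_mem_nhds ht
  have hTt : 0 < T - t := sub_pos.mpr htT
  have hv : ContDiff ℝ ∞ (u t) := hsol.contDiff_velocity ht'
  have hω : IsSmoothSpaceTimeOn S (vorticity u) := (hsol.smooth_velocity.fderiv_slice hS).clm_comp curlCLM
  obtain ⟨w, hwdef⟩ : ∃ w, w = timeDerivWithin S (vorticity u) t x := ⟨_, rfl⟩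
  have hd : HasDerivAt (fun s => curl (u s) x) w t := by
    rw [hwdef]
    exact (hω.hasDerivWithinAt_timeDerivWithin hS ht' x).hasDerivAt ht
  have hvort := (hsol.isVorticitySolutionOn_of_uniqueDiffOn hS (fun s _ y => curl_zero y)).vorticity_eq t ht' x
  rw [← hwdef] at hvort
  obtain ⟨h1, hlap⟩ := inner_vorticity_rhs_eq_at_argmax ν hv hmaxX hne hvort
  obtain ⟨h2, hstat⟩ := fermat_two_sided_of_hasDerivAt hd htT hmaxT
  have hρ : 0 < ‖curl (u t) x‖ := norm_pos_iff.mpr hne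
  obtain ⟨r, hrdef⟩ : ∃ r : ℝ, r =
      ⟪vorticityDirection (curl (u t)) x, fderiv ℝ (u t) x (vorticityDirection (curl (u t)) x)⟫ -
        ν * frobeniusNormSq (fderiv ℝ (vorticityDirection (curl (u t))) x) := ⟨_, rfl⟩
  obtain ⟨L, hLdef⟩ : ∃ L : ℝ, L = (Δ fun y => ‖curl (u t) y‖) x := ⟨_, rfl⟩
  rw [← hrdef, ← hLdef] at h1
  rw [← hLdef] at hlap
  rw [← hrdef, ← hLdef]
  -- `ρ² = (T − t)(r ρ² + ν ρ L)` ⇒ `ρ = (T − t)(r ρ + ν L)`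
  have key : ‖curl (u t) x‖ * ‖curl (u t) x‖ =
      ‖curl (u t) x‖ * ((T - t) * (r * ‖curl (u t) x‖ + ν * L)) := by
    have e : ‖curl (u t) x‖ ^ 2 = (T - t) * (r * ‖curl (u t) x‖ ^ 2 + ν * ‖curl (u t) x‖ * L) := by
      have h := h2; rw [h1] at h; exact h
    nlinarith [e]
  have key' := mul_left_cancel₀ hρ.ne' key
  have hX : (T - t) * ν * -L / ‖curl (u t) x‖ = (T - t) * r - 1 := by
    rw [div_eq_iff hρ.ne']
    linear_combination key'
  exact ⟨by linarith [hX], by linarith [hlap], hstat⟩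

/-! ## §J3 The record identity on the tangent field of a Type-I solution -/

/-- ★★★ **THE RECORD IDENTITY ON THE TANGENT FIELD.**  For every classical Type-I solution `(u,p)` on
`(−∞,0) × ℝ³` (`|u| ≤ C₀/(|x| + √(−t))`, `ω ≢ 0`), the tangent field `v` and the point `z̄` of PART H/I
(`|ω_v(−1, z̄)| = W* = sup (0−s)|ω_u|`, dominating both vorticity numbers) satisfy, with `ρ̄ = |ω_v(−1,z̄)|`,
`ξ̄ = ξ_v(−1,z̄)`, `ᾱ = ⟪ξ̄, ∇v(−1,z̄) ξ̄⟫`: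
(i) STATIONARITY: `s ↦ (0 − s)²|ω_v(s,z̄)|²` has derivative `0` at `s = −1` and `∇|ω_v(−1,·)|²(z̄) = 0`;
(ii) THE IDENTITY: `(0 − (−1))(ᾱ − |∇ξ̄|²_F) = 1 + (0 − (−1))·(−Δ|ω_v(−1,·)|(z̄))/ρ̄`, `0 ≤ −Δ|ω_v(−1,·)|(z̄)`.
(The record of the tangent field is attained in the INTERIOR of its time range, so Fermat is two-sided.)
[new-as-typed] -/
theorem typeI_tangent_record_identity {C₀ : ℝ}
    {u : ℝ → (EuclideanSpace ℝ (Fin 3)) → (EuclideanSpace ℝ (Fin 3))} {p : ℝ → (EuclideanSpace ℝ (Fin 3)) → ℝ}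
    (hsol : IsClassicalNSSolutionOn (Iio 0) 1 0 u p) (hI : HasTypeIDecay C₀ u)
    (hcurl : ∃ t₀ : ℝ, t₀ < 0 ∧ ∃ x₀ : EuclideanSpace ℝ (Fin 3), curl (u t₀) x₀ ≠ 0) :
    ∃ (v : ℝ → (EuclideanSpace ℝ (Fin 3)) → (EuclideanSpace ℝ (Fin 3))) (zbar : EuclideanSpace ℝ (Fin 3)),
      Continuous (uncurry v) ∧
      (∃ lam : ℕ → ℝ, (∀ j, 0 < lam j) ∧ ∀ t ≤ -(1/4 : ℝ), ∀ x,
          Tendsto (fun j => nsRescale (lam j) u t x) atTop (𝓝 (v t x)) ∧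
          Tendsto (fun j => fderiv ℝ (nsRescale (lam j) u t) x) atTop (𝓝 (fderiv ℝ (v t) x)) ∧
          Tendsto (fun j => curl (nsRescale (lam j) u t) x) atTop (𝓝 (curl (v t) x))) ∧
      (∀ t ≤ -(1/4 : ℝ), ∀ x, ‖v t x‖ ≤ C₀ / (‖x‖ + √(-t))) ∧
      IsBoundedWeakNSSolutionOn (Iio 0) isOpen_Iio 1 (fun t => v (t - 1/4)) ∧
      (∀ t ≤ -(1/2 : ℝ), ContDiff ℝ ∞ (v t)) ∧
      (∀ t ≤ -(1/2 : ℝ), ∀ x, HasDerivAt (fun s => curl (v s) x)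
          ((Δ (curl (v t))) x - fderiv ℝ (curl (v t)) x (v t x) + fderiv ℝ (v t) x (curl (v t) x)) t) ∧
      curl (v (-1)) zbar ≠ 0 ∧
      (∀ s : ℝ, s < 0 → ∀ y, (0 - s) * ‖curl (u s) y‖ ≤ (0 - (-1)) * ‖curl (v (-1)) zbar‖) ∧
      (∀ s ≤ -(1/4 : ℝ), ∀ y, (0 - s) * ‖curl (v s) y‖ ≤ (0 - (-1)) * ‖curl (v (-1)) zbar‖) ∧
      HasDerivAt (fun s => (0 - s) ^ 2 * ‖curl (v s) zbar‖ ^ 2) 0 (-1) ∧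
      fderiv ℝ (fun y => ‖curl (v (-1)) y‖ ^ 2) zbar = 0 ∧
      0 ≤ -(Δ fun y => ‖curl (v (-1)) y‖) zbar ∧
      (0 - (-1)) *
          (⟪vorticityDirection (curl (v (-1))) zbar,
              fderiv ℝ (v (-1)) zbar (vorticityDirection (curl (v (-1))) zbar)⟫ -
            frobeniusNormSq (fderiv ℝ (vorticityDirection (curl (v (-1)))) zbar)) =
        1 + (0 - (-1)) * (-(Δ fun y => ‖curl (v (-1)) y‖) zbar) / ‖curl (v (-1)) zbar‖ := by
  obtain ⟨W, hW, hnum, -, lam, hlam, v, zbar, hvc, hconv, -, hfd, hcurlc, hTypeI, hweak, -, hnumv, hatt⟩ :=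
    typeI_tangent_vorticity_attains hsol hI hcurl
  have hwin := fun t (ht : t ≤ -(1/2 : ℝ)) (x : EuclideanSpace ℝ (Fin 3)) =>
    tangent_vorticity_eq hvc hTypeI hweak ht x
  have eW : (0 - (-1 : ℝ)) * ‖curl (v (-1)) zbar‖ = W := by rw [hatt]; ring
  have hne : curl (v (-1)) zbar ≠ 0 := by
    rw [← norm_pos_iff, hatt]; exact hW
  have hρ : 0 < ‖curl (v (-1)) zbar‖ := norm_pos_iff.mpr hne
  have hmaxX : ∀ y, ‖curl (v (-1)) y‖ ≤ ‖curl (v (-1)) zbar‖ := fun y => by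
    have h := hnumv (-1) (by norm_num) y
    rw [hatt]; linarith
  -- the record is TWO-SIDED in time: `(0 − s)|ω_v(s,z̄)| ≤ W` for all `s ≤ −1/4`, a neighbourhood of `−1`
  have hrec : IsLocalMax (fun s => (0 - s) * ‖curl (v s) zbar‖) (-1) := by
    show ∀ᶠ s in 𝓝 (-1 : ℝ), (0 - s) * ‖curl (v s) zbar‖ ≤ (0 - (-1)) * ‖curl (v (-1)) zbar‖
    filter_upwards [Iic_mem_nhds (show (-1 : ℝ) < -(1/4 : ℝ) by norm_num)] with s hs
    rw [eW]
    exact hnumv s hs zbar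
  obtain ⟨hsm, hD⟩ := hwin (-1) (by norm_num) zbar
  have heq : ((Δ (curl (v (-1)))) zbar - fderiv ℝ (curl (v (-1))) zbar (v (-1) zbar) +
        fderiv ℝ (v (-1)) zbar (curl (v (-1)) zbar)) + convect (v (-1)) (curl (v (-1))) zbar =
      convect (curl (v (-1))) (v (-1)) zbar + (1 : ℝ) • (Δ (curl (v (-1)))) zbar := by
    simp only [convect_apply, one_smul]; abel
  obtain ⟨h1, hlap⟩ := inner_vorticity_rhs_eq_at_argmax 1 hsm hmaxX hne heq
  obtain ⟨h2, hstat⟩ := fermat_two_sided_of_hasDerivAt hD (by norm_num : (-1 : ℝ) < 0) hrec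
  -- spatial stationarity of `|ω|²`
  have hcrit : fderiv ℝ (fun y => ‖curl (v (-1)) y‖ ^ 2) zbar = 0 := by
    have hloc : IsLocalMax (fun y => ‖curl (v (-1)) y‖ ^ 2) zbar :=
      Filter.Eventually.of_forall fun y => pow_le_pow_left₀ (norm_nonneg _) (hmaxX y) 2
    exact hloc.fderiv_eq_zero
  obtain ⟨r, hrdef⟩ : ∃ r : ℝ, r =
      ⟪vorticityDirection (curl (v (-1))) zbar,
          fderiv ℝ (v (-1)) zbar (vorticityDirection (curl (v (-1))) zbar)⟫ -
        1 * frobeniusNormSq (fderiv ℝ (vorticityDirection (curl (v (-1)))) zbar) := ⟨_, rfl⟩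
  obtain ⟨L, hLdef⟩ : ∃ L : ℝ, L = (Δ fun y => ‖curl (v (-1)) y‖) zbar := ⟨_, rfl⟩
  rw [← hrdef, ← hLdef] at h1
  have hr' : ⟪vorticityDirection (curl (v (-1))) zbar,
          fderiv ℝ (v (-1)) zbar (vorticityDirection (curl (v (-1))) zbar)⟫ -
        frobeniusNormSq (fderiv ℝ (vorticityDirection (curl (v (-1)))) zbar) = r := by rw [hrdef, one_mul]
  have key : ‖curl (v (-1)) zbar‖ * ‖curl (v (-1)) zbar‖ =
      ‖curl (v (-1)) zbar‖ * ((0 - (-1)) * (r * ‖curl (v (-1)) zbar‖ + 1 * L)) := by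
    have e : ‖curl (v (-1)) zbar‖ ^ 2 =
        (0 - (-1)) * (r * ‖curl (v (-1)) zbar‖ ^ 2 + 1 * ‖curl (v (-1)) zbar‖ * L) := by
      have h := h2; rw [h1] at h; exact h
    nlinarith [e]
  have key' := mul_left_cancel₀ hρ.ne' key
  have hX : (0 - (-1)) * -L / ‖curl (v (-1)) zbar‖ = (0 - (-1)) * r - 1 := by
    rw [div_eq_iff hρ.ne']
    linear_combination key'
  refine ⟨v, zbar, hvc, ⟨lam, hlam, fun t ht x => ⟨hconv t ht x, hfd t ht x, hcurlc t ht x⟩⟩, hTypeI, hweak,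
    fun t ht => (hwin t ht 0).1, fun t ht x => (hwin t ht x).2, hne,
    fun s hs y => eW ▸ hnum s hs y, fun s hs y => eW ▸ hnumv s hs y, hstat, hcrit, by linarith [hlap], ?_⟩
  rw [hr', ← hLdef]
  linarith [hX]

/-! ## §J4 The record identity for DSS singularities -/

/-- ★★ **THE RECORD IDENTITY OF A DSS SINGULARITY.**  Classical unforced solution on `(−∞,0)` (`ν ≥ 0` not even
needed for the identity), `c`-DSS (`c > 1`), gradient decaying at spatial infinity over a period, `ω ≢ 0`.  At the
ATTAINED vorticity record `(t_ω, x_ω)` of R53 (`dss_vorticityNumber_attained`) the record is two-sided in time, and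
`(0 − t_ω)(α − ν|∇ξ|²_F) = 1 + (0 − t_ω)·ν·(−Δ|ω|(t_ω,x_ω))/|ω(t_ω,x_ω)|`, `0 ≤ −Δ|ω|(t_ω,x_ω)`,
`∂_s[(0 − s)²|ω(s,x_ω)|²](t_ω) = 0`. [new-as-typed] -/
theorem dss_vorticity_record_identity {ν c : ℝ} (hc : 1 < c)
    {u : ℝ → (EuclideanSpace ℝ (Fin 3)) → (EuclideanSpace ℝ (Fin 3))} {p : ℝ → (EuclideanSpace ℝ (Fin 3)) → ℝ}
    (hsol : IsClassicalNSSolutionOn (Iio 0) ν 0 u p) (hdss : IsDiscretelySelfSimilar c u)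
    (hdecay : ∀ ε : ℝ, 0 < ε → ∃ R : ℝ, ∀ t ∈ Icc (-(c ^ 2)) (-1), ∀ x : EuclideanSpace ℝ (Fin 3),
      R ≤ ‖x‖ → ‖fderiv ℝ (u t) x‖ ≤ ε)
    (hcurl : ∃ t₀ : ℝ, t₀ < 0 ∧ ∃ x₀ : EuclideanSpace ℝ (Fin 3), curl (u t₀) x₀ ≠ 0) :
    ∃ t : ℝ, t < 0 ∧ ∃ x : EuclideanSpace ℝ (Fin 3), curl (u t) x ≠ 0 ∧
      (∀ s : ℝ, s < 0 → ∀ y : EuclideanSpace ℝ (Fin 3), (0 - s) * ‖curl (u s) y‖ ≤ (0 - t) * ‖curl (u t) x‖) ∧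
      (0 - t) *
          (⟪vorticityDirection (curl (u t)) x, fderiv ℝ (u t) x (vorticityDirection (curl (u t)) x)⟫ -
            ν * frobeniusNormSq (fderiv ℝ (vorticityDirection (curl (u t))) x)) =
        1 + (0 - t) * ν * (-(Δ fun y => ‖curl (u t) y‖) x) / ‖curl (u t) x‖ ∧
      0 ≤ -(Δ fun y => ‖curl (u t) y‖) x ∧
      HasDerivAt (fun s => (0 - s) ^ 2 * ‖curl (u s) x‖ ^ 2) 0 t := by
  obtain ⟨t, ht, x, hne, hsup⟩ := dss_vorticityNumber_attained hc hsol.smooth_velocity hdss hdecay hcurl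
  have hS : UniqueDiffOn ℝ (Iio (0 : ℝ)) := uniqueDiffOn_Iio 0
  have htn : Iio (0 : ℝ) ∈ 𝓝 t := Iio_mem_nhds ht
  have hTt : 0 < 0 - t := by linarith
  have hmaxX : ∀ y, ‖curl (u t) y‖ ≤ ‖curl (u t) x‖ := fun y => le_of_mul_le_mul_left (hsup t ht y) hTt
  have hmaxT : IsLocalMax (fun s => (0 - s) * ‖curl (u s) x‖) t := by
    show ∀ᶠ s in 𝓝 t, (0 - s) * ‖curl (u s) x‖ ≤ (0 - t) * ‖curl (u t) x‖
    filter_upwards [htn] with s hs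
    exact hsup s hs x
  obtain ⟨h1, h2, h3⟩ := vorticity_record_identity hS hsol htn ht hmaxX hmaxT hne
  exact ⟨t, ht, x, hne, hsup, h1, h2, h3⟩

end Summit.NavierStokesRegularity.NavierStokesRegularity.Theorems.StrainDoors

end
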